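import Summits.CriticalPhenomena.SAWScalingLimit.Theorems.SAWDefectDecoherenceObservableToSLERTwoPieceAdmIdentificationFlat
import Summits.CriticalPhenomena.SAWScalingLimit.Theorems.SAWDevelopingMapObservableToSLECanonicalTransferAdmissibleBits
import HarnessLib

/-!
# Crux `SAWDefectDecoherence.ObservableToSLER` (stmt-CriticalPhenomena-14005), line
`bridge-gate-renewal` (r7), stub 5a3 `stub_twoPieceAdmIdentification`: the admissible sub-family
at a fixed mesh (component of the source in the vertices far from the exclusion set)

Landing target:
`Summits/CriticalPhenomena/SAWScalingLimit/Theorems/SAWDefectDecoherenceObservableToSLERTwoPieceAdmIdentificationComponent.lean`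
(`--supports stmt-CriticalPhenomena-14005`).  Sequel of `…TwoPieceAdmIdentificationFlat`.

THE CONSTRUCTION.  At a fixed mesh `δ`, given a vertex family `Λ` (the admissible family of the
two-piece flat domain `Ω` at this mesh), a closed EXCLUSION SET `T ⊆ ℂ` (in the application: the
image under the boundary extension `φ̂` of the pulled-back hull `A` of a hull subdomain `Ω'`
together with two real whiskers, so that `Ω ∖ Ω' ⊆ T`, `T ∩ Ω' = ∅`, and every point of `T` is
joined INSIDE `T` by a connected set to a floor point of the flat ball at the second marked point
`p₁`) and the source vertex `v_a`, put
`{u : HexVertex | u ∈ Λ ∧ ∀ y ∈ T, 6 * δ < dist ((δ : ℂ) * hexCenter u) y} = {u ∈ Λ | dist (δ c_u, T) > 6δ}` and let the SUB-FAMILY `subFamily Λ T δ v_a` be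
the set of vertices joined to `v_a` by a honeycomb path inside `deepSet` (a `Finset`, `⊆ Λ`).

PROVED HERE (all at the fixed mesh, under explicit smallness `8δ ≤ L`, `4L ≤ ρ`):
* `subFamily_subset`, `mem_subFamily_iff`, `preconnected_subFamily` (connected);
* `center_mem_of_mem_subFamily` — its rescaled centres lie in `Ω'` (from `Ω ∖ Ω' ⊆ T`);
* `escape_of_near` — THE ESCAPE: a vertex of `Λ` within `6δ` of `T` is joined OUTSIDE `deepSet`
  to a vertex outside `Λ` (greedy descent to `T`, a walk hugging the connected piece of `T`
  through that point down to its floor point near `p₁` — `exists_walk_within_of_isPreconnected` —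
  and column descent below the floor, `not_mem_of_below_floor`);
* `exists_escape`, `simplyConnected_subFamily` — hence EVERY vertex off the sub-family escapes to
  `Λᶜ` avoiding the sub-family (foreign components exit through a non-deep neighbour), and the
  sub-family is SIMPLY CONNECTED (`hexDomainSimplyConnected`: connected complement), `Λ` being so;
* `pathIn_deepSet_of_low`, `pathIn_deepSet_of_high` — vertices above the floor row near a marked
  point, and vertices near its hub, are joined inside `deepSet` to the hub vertices (so the exact
  floor rows at `p₀` belong to the sub-family, and so do they at `p₁` once one hub vertex does).
-/

noncomputable section

open scoped Topology Classical
open Filter Set Metric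
open Literature.Probability.LatticeModels (HexVertex hexGraph hexCenter Site polyline)
open Literature.Probability.RandomPlanarGeometry
open Literature.Probability.RandomPlanarGeometry.SAW
open Literature.Probability.Percolation (PathIn)

namespace Summit.CriticalPhenomena.SAWScalingLimit.Theorems.ObservableToSLER.TwoPiece

open Summit.CriticalPhenomena.SAWScalingLimit.Theorems.ObservableToSLE.FloorRatio

/-! ### The deep vertices and the sub-family -/

variable {Λ : Finset HexVertex} {T : Set ℂ} {δ : ℝ} {va : HexVertex}

/-- Deep vertices are vertices of `Λ`. [folklore] -/
theorem deepSet_subset : {u : HexVertex | u ∈ Λ ∧ ∀ y ∈ T, 6 * δ < dist ((δ : ℂ) * hexCenter u) y} ⊆ (↑Λ : Set HexVertex) := fun _ hu => hu.1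

/-- Membership in the sub-family. [folklore] -/
theorem mem_subFamily_iff {z : HexVertex} :
    z ∈ (Λ.filter fun z => PathIn hexGraph {u : HexVertex | u ∈ Λ ∧ ∀ y ∈ T, 6 * δ < dist ((δ : ℂ) * hexCenter u) y} va z) ↔ PathIn hexGraph ({u : HexVertex | u ∈ Λ ∧ ∀ y ∈ T, 6 * δ < dist ((δ : ℂ) * hexCenter u) y}) va z := by
  rw [Finset.mem_filter]
  exact ⟨fun h => h.2, fun h => ⟨h.right_mem.1, h⟩⟩

/-- The sub-family is contained in `Λ`. [folklore] -/
theorem subFamily_subset : (Λ.filter fun z => PathIn hexGraph {u : HexVertex | u ∈ Λ ∧ ∀ y ∈ T, 6 * δ < dist ((δ : ℂ) * hexCenter u) y} va z) ⊆ Λ := fun _ hz =>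
  (mem_subFamily_iff.1 hz).right_mem.1

/-- The sub-family consists of deep vertices. [folklore] -/
theorem subFamily_subset_deepSet : (↑((Λ.filter fun z => PathIn hexGraph {u : HexVertex | u ∈ Λ ∧ ∀ y ∈ T, 6 * δ < dist ((δ : ℂ) * hexCenter u) y} va z)) : Set HexVertex) ⊆ {u : HexVertex | u ∈ Λ ∧ ∀ y ∈ T, 6 * δ < dist ((δ : ℂ) * hexCenter u) y} :=
  fun _ hz => (mem_subFamily_iff.1 (Finset.mem_coe.1 hz)).right_mem

/-- A path inside `A` from `x` runs inside any set containing all `A`-reachable points of `x`.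
[folklore] -/
theorem pathIn_of_forall_reachable {V : Type*} {G : SimpleGraph V} {A B : Set V} {x y : V}
    (h : PathIn G A x y) (hB : ∀ u, PathIn G A x u → u ∈ B) : PathIn G B x y := by
  obtain ⟨hx, h⟩ := h
  induction h with
  | refl => exact PathIn.refl (hB x (PathIn.refl hx))
  | @tail b c hxb hbc ih =>
    exact ih.tail hbc.1 (hB c (show PathIn G A x c from ⟨hx, hxb.tail hbc⟩))

/-- **The sub-family is connected.** [folklore] -/
theorem preconnected_subFamily :
    (hexGraph.induce (↑((Λ.filter fun z => PathIn hexGraph {u : HexVertex | u ∈ Λ ∧ ∀ y ∈ T, 6 * δ < dist ((δ : ℂ) * hexCenter u) y} va z)) : Set HexVertex)).Preconnected := by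
  refine preconnected_induce_of_forall_pathIn fun x hx y hy => ?_
  have hx' := mem_subFamily_iff.1 (Finset.mem_coe.1 hx)
  have hy' := mem_subFamily_iff.1 (Finset.mem_coe.1 hy)
  exact pathIn_of_forall_reachable (hx'.symm.trans hy') fun u hu =>
    Finset.mem_coe.2 (mem_subFamily_iff.2 (hx'.trans hu))

/-- **The rescaled centres of the sub-family lie in the subdomain**: if `Λ ⊆ Ω` (centres) and
`Ω ∖ Ω' ⊆ T`, every vertex of the sub-family has its rescaled centre in `Ω'`. [folklore] -/
theorem center_mem_of_mem_subFamily {Ω Ω' : Set ℂ} (hδ : 0 ≤ δ)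
    (hΛΩ : ∀ v ∈ Λ, (δ : ℂ) * hexCenter v ∈ Ω) (hT : Ω \ Ω' ⊆ T) {z : HexVertex}
    (hz : z ∈ (Λ.filter fun z => PathIn hexGraph {u : HexVertex | u ∈ Λ ∧ ∀ y ∈ T, 6 * δ < dist ((δ : ℂ) * hexCenter u) y} va z)) : (δ : ℂ) * hexCenter z ∈ Ω' := by
  have hdeep := subFamily_subset_deepSet (Finset.mem_coe.2 hz)
  by_contra h
  have := hdeep.2 _ (hT ⟨hΛΩ z hdeep.1, h⟩)
  rw [dist_self] at this
  linarith

/-! ### The escape -/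

section Escape

variable {Ω : Set ℂ} {p₁ : ℂ} {ρ : ℝ} {m₁ : ℤ}

/-- Vertices within `6δ` of a point of `T` are not deep. [folklore] -/
theorem not_mem_deepSet_of_dist_le {u : HexVertex} {y : ℂ} (hy : y ∈ T)
    (hu : dist ((δ : ℂ) * hexCenter u) y ≤ 6 * δ) : u ∉ {u : HexVertex | u ∈ Λ ∧ ∀ y ∈ T, 6 * δ < dist ((δ : ℂ) * hexCenter u) y} :=
  fun h => (h.2 y hy).not_ge hu

/-- **THE ESCAPE.**  Let `Ω` be flat at `p₁` at scale `ρ` with `Λ ⊆ Ω` the exact rows `≥ m₁` in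
`B(p₁, ρ)`, `0 < 8δ ≤ ρ`, and let every point `y` of the exclusion set `T` lie in a preconnected
`T_y ⊆ T` containing a floor point `q` (`Im q = Im p₁`, `dist q p₁ < ρ/4`).  Then every vertex
within `6δ` of a point of `T` is joined OUTSIDE the deep set to a vertex outside `Λ`: greedy
descent to `y`, a walk hugging `T_y` to within `δ` of `q` (`exists_walk_within_of_isPreconnected`,
all vertices within `δ` of `T`), and column descent by `3δ` below the floor
(`not_mem_of_below_floor`). [folklore] -/
theorem escape_of_near (hδ : 0 < δ) (hδρ : 8 * δ ≤ ρ)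
    (hflat : Ω ∩ ball p₁ ρ = {z : ℂ | p₁.im < z.im} ∩ ball p₁ ρ)
    (hΛΩ : ∀ v ∈ Λ, (δ : ℂ) * hexCenter v ∈ Ω)
    (hrow : ∀ v : HexVertex, (δ : ℂ) * hexCenter v ∈ ball p₁ ρ → (v ∈ Λ ↔ m₁ ≤ v.1 1))
    (hT : ∀ y ∈ T, ∃ Ty ⊆ T, IsPreconnected Ty ∧ y ∈ Ty ∧
      ∃ q ∈ Ty, q.im = p₁.im ∧ dist q p₁ < ρ / 4)
    {x : HexVertex} {y : ℂ} (hy : y ∈ T) (hxy : dist ((δ : ℂ) * hexCenter x) y ≤ 6 * δ) :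
    ∃ w : HexVertex, w ∉ Λ ∧ PathIn hexGraph ({u : HexVertex | u ∈ Λ ∧ ∀ y ∈ T, 6 * δ < dist ((δ : ℂ) * hexCenter u) y})ᶜ x w := by
  obtain ⟨Ty, hTyT, hTy, hyTy, q, hq, hqim, hqp⟩ := hT y hy
  have h3 := div_sqrt_three_le hδ.le
  -- greedy to `y`
  obtain ⟨z, p₀, hz, hp₀⟩ := exists_walk_dist_smul_le hδ x y
  have hP₀ : PathIn hexGraph ({u : HexVertex | u ∈ Λ ∧ ∀ y ∈ T, 6 * δ < dist ((δ : ℂ) * hexCenter u) y})ᶜ x z :=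
    pathIn_of_walk p₀ fun u hu => not_mem_deepSet_of_dist_le hy ((hp₀ u hu).trans hxy)
  -- hug `T_y` down to `q`
  obtain ⟨z', p₁', hz', hp₁'⟩ := exists_walk_within_of_isPreconnected hTy hδ le_rfl hyTy hq
    (v := z) (hz.trans h3)
  have hP₁ : PathIn hexGraph ({u : HexVertex | u ∈ Λ ∧ ∀ y ∈ T, 6 * δ < dist ((δ : ℂ) * hexCenter u) y})ᶜ z z' :=
    pathIn_of_walk p₁' fun u hu => by
      obtain ⟨t, ht, hut⟩ := hp₁' u hu
      exact not_mem_deepSet_of_dist_le (hTyT ht) (hut.trans (by linarith))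
  -- column descent by `3δ`
  obtain ⟨w, p₂, hw, hp₂⟩ := exists_walk_column hδ z' (L := 3 * δ) (by linarith)
  have hz'im : ((δ : ℂ) * hexCenter z').im ≤ p₁.im + δ := by
    have him := Complex.abs_im_le_norm ((δ : ℂ) * hexCenter z' - q)
    rw [← dist_eq_norm, Complex.sub_im, hqim] at him
    linarith [(abs_le.1 (him.trans hz')).2]
  have hP₂ : PathIn hexGraph ({u : HexVertex | u ∈ Λ ∧ ∀ y ∈ T, 6 * δ < dist ((δ : ℂ) * hexCenter u) y})ᶜ z' w :=
    pathIn_of_walk p₂ fun u hu => not_mem_deepSet_of_dist_le (hTyT hq) (by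
      have := (hp₂ u hu).2.2.2
      have := dist_triangle ((δ : ℂ) * hexCenter u) ((δ : ℂ) * hexCenter z') q
      linarith)
  refine ⟨w, ?_, (hP₀.trans hP₁).trans hP₂⟩
  -- `w` is below the floor in the flat ball, hence not in `Λ`
  have hwq : dist ((δ : ℂ) * hexCenter w) q ≤ 6 * δ := by
    have := (hp₂ w p₂.end_mem_support).2.2.2
    have := dist_triangle ((δ : ℂ) * hexCenter w) ((δ : ℂ) * hexCenter z') q
    linarith
  refine not_mem_of_below_floor hδ (by linarith) hflat hΛΩ hrow ?_ (by linarith)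
  rw [mem_ball]
  have := dist_triangle ((δ : ℂ) * hexCenter w) q p₁
  linarith

/-- **Every vertex off the sub-family escapes to `Λᶜ` avoiding the sub-family** (under the
hypotheses of `escape_of_near`): either it is outside `Λ`, or it is a non-deep vertex of `Λ`
(`escape_of_near`), or it is a deep vertex in a foreign component, which is left through a
non-deep neighbour (first exit of a path to a vertex outside the finite set `Λ`). [folklore] -/
theorem exists_escape (hδ : 0 < δ) (hδρ : 8 * δ ≤ ρ)
    (hflat : Ω ∩ ball p₁ ρ = {z : ℂ | p₁.im < z.im} ∩ ball p₁ ρ)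
    (hΛΩ : ∀ v ∈ Λ, (δ : ℂ) * hexCenter v ∈ Ω)
    (hrow : ∀ v : HexVertex, (δ : ℂ) * hexCenter v ∈ ball p₁ ρ → (v ∈ Λ ↔ m₁ ≤ v.1 1))
    (hT : ∀ y ∈ T, ∃ Ty ⊆ T, IsPreconnected Ty ∧ y ∈ Ty ∧
      ∃ q ∈ Ty, q.im = p₁.im ∧ dist q p₁ < ρ / 4)
    {x : HexVertex} (hx : x ∉ (Λ.filter fun z => PathIn hexGraph {u : HexVertex | u ∈ Λ ∧ ∀ y ∈ T, 6 * δ < dist ((δ : ℂ) * hexCenter u) y} va z)) :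
    ∃ w : HexVertex, w ∉ Λ ∧ PathIn hexGraph (↑((Λ.filter fun z => PathIn hexGraph {u : HexVertex | u ∈ Λ ∧ ∀ y ∈ T, 6 * δ < dist ((δ : ℂ) * hexCenter u) y} va z)) : Set HexVertex)ᶜ x w := by
  have hsub : ({u : HexVertex | u ∈ Λ ∧ ∀ y ∈ T, 6 * δ < dist ((δ : ℂ) * hexCenter u) y})ᶜ ⊆ (↑((Λ.filter fun z => PathIn hexGraph {u : HexVertex | u ∈ Λ ∧ ∀ y ∈ T, 6 * δ < dist ((δ : ℂ) * hexCenter u) y} va z)) : Set HexVertex)ᶜ :=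
    compl_subset_compl.2 subFamily_subset_deepSet
  -- non-deep vertices escape
  have hnd : ∀ u : HexVertex, u ∉ {u : HexVertex | u ∈ Λ ∧ ∀ y ∈ T, 6 * δ < dist ((δ : ℂ) * hexCenter u) y} →
      ∃ w : HexVertex, w ∉ Λ ∧ PathIn hexGraph (↑((Λ.filter fun z => PathIn hexGraph {u : HexVertex | u ∈ Λ ∧ ∀ y ∈ T, 6 * δ < dist ((δ : ℂ) * hexCenter u) y} va z)) : Set HexVertex)ᶜ u w := by
    intro u hu
    by_cases huΛ : u ∈ Λ
    · have : ¬ ∀ y ∈ T, 6 * δ < dist ((δ : ℂ) * hexCenter u) y := fun h => hu ⟨huΛ, h⟩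
      push Not at this
      obtain ⟨y, hy, hle⟩ := this
      obtain ⟨w, hw, hP⟩ := escape_of_near hδ hδρ hflat hΛΩ hrow hT hy hle
      exact ⟨w, hw, hP.mono hsub⟩
    · exact ⟨u, huΛ, PathIn.refl (hsub (fun h => huΛ h.1))⟩
  by_cases hxd : x ∈ {u : HexVertex | u ∈ Λ ∧ ∀ y ∈ T, 6 * δ < dist ((δ : ℂ) * hexCenter u) y}
  · -- a deep vertex in a foreign component
    set C : Set HexVertex := {z | PathIn hexGraph ({u : HexVertex | u ∈ Λ ∧ ∀ y ∈ T, 6 * δ < dist ((δ : ℂ) * hexCenter u) y}) x z} with hC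
    have hCsub : C ⊆ (↑((Λ.filter fun z => PathIn hexGraph {u : HexVertex | u ∈ Λ ∧ ∀ y ∈ T, 6 * δ < dist ((δ : ℂ) * hexCenter u) y} va z)) : Set HexVertex)ᶜ := by
      intro z hz hz'
      exact hx (mem_subFamily_iff.2 ((mem_subFamily_iff.1 (Finset.mem_coe.1 hz')).trans hz.symm))
    -- a vertex outside the finite set `Λ`
    obtain ⟨t, ht⟩ : ∃ t : HexVertex, t ∉ Λ := by
      by_contra h
      push Not at h
      exact (Set.infinite_univ (α := HexVertex)) ((Λ.finite_toSet).subset fun z _ => h z)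
    obtain ⟨p⟩ := hexGraph_connected.preconnected x t
    have hxt : PathIn hexGraph univ x t := pathIn_of_walk p fun _ _ => mem_univ _
    have htC : t ∉ C := fun h => ht h.right_mem.1
    obtain ⟨a, b, haC, hbC, -, hab, hxa⟩ := hxt.exit (R := C) (PathIn.refl hxd) htC
    have hbd : b ∉ {u : HexVertex | u ∈ Λ ∧ ∀ y ∈ T, 6 * δ < dist ((δ : ℂ) * hexCenter u) y} := fun hbd => hbC (haC.tail hab hbd)
    obtain ⟨w, hw, hbw⟩ := hnd b hbd
    refine ⟨w, hw, ((hxa.mono fun z hz => hCsub hz.1).tail hab (hsub hbd)).trans hbw⟩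
  · exact hnd x hxd

/-- From preconnectedness of an induced subgraph to `PathIn` chains. [folklore] -/
theorem pathIn_of_preconnected_induce {V : Type*} {G : SimpleGraph V} {S : Set V}
    (h : (G.induce S).Preconnected) {x y : V} (hx : x ∈ S) (hy : y ∈ S) : PathIn G S x y := by
  obtain ⟨p⟩ := h ⟨x, hx⟩ ⟨y, hy⟩
  obtain ⟨q, hq⟩ := exists_walk_of_induce p
  exact pathIn_of_walk q hq

/-- **THE SUB-FAMILY IS SIMPLY CONNECTED** (connected complement, `hexDomainSimplyConnected`),
`Λ` being so: any two vertices off the sub-family escape to `Λᶜ` avoiding it (`exists_escape`),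
and `Λᶜ ⊆ (sub-family)ᶜ` is connected. [cite: DuminilCopinSmirnov2012, §2 (domains: simply connected = connected complement)] -/
theorem simplyConnected_subFamily (hδ : 0 < δ) (hδρ : 8 * δ ≤ ρ)
    (hflat : Ω ∩ ball p₁ ρ = {z : ℂ | p₁.im < z.im} ∩ ball p₁ ρ)
    (hΛΩ : ∀ v ∈ Λ, (δ : ℂ) * hexCenter v ∈ Ω)
    (hrow : ∀ v : HexVertex, (δ : ℂ) * hexCenter v ∈ ball p₁ ρ → (v ∈ Λ ↔ m₁ ≤ v.1 1))
    (hT : ∀ y ∈ T, ∃ Ty ⊆ T, IsPreconnected Ty ∧ y ∈ Ty ∧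
      ∃ q ∈ Ty, q.im = p₁.im ∧ dist q p₁ < ρ / 4)
    (hsc : hexDomainSimplyConnected Λ) :
    hexDomainSimplyConnected ((Λ.filter fun z => PathIn hexGraph {u : HexVertex | u ∈ Λ ∧ ∀ y ∈ T, 6 * δ < dist ((δ : ℂ) * hexCenter u) y} va z)) := by
  unfold hexDomainSimplyConnected at hsc ⊢
  refine preconnected_induce_of_forall_pathIn fun x hx y hy => ?_
  obtain ⟨x', hx', hxx'⟩ := exists_escape (va := va) hδ hδρ hflat hΛΩ hrow hT hx
  obtain ⟨y', hy', hyy'⟩ := exists_escape (va := va) hδ hδρ hflat hΛΩ hrow hT hy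
  have hΛc : (↑Λ : Set HexVertex)ᶜ ⊆ (↑((Λ.filter fun z => PathIn hexGraph {u : HexVertex | u ∈ Λ ∧ ∀ y ∈ T, 6 * δ < dist ((δ : ℂ) * hexCenter u) y} va z)) : Set HexVertex)ᶜ :=
    compl_subset_compl.2 (Finset.coe_subset.2 subFamily_subset)
  exact (hxx'.trans ((pathIn_of_preconnected_induce hsc hx' hy').mono hΛc)).trans hyy'.symm

end Escape

/-! ### The flat zones belong to the deep set -/

section Flat

variable {p : ℂ} {ρ L : ℝ} {m : ℤ}

/-- **Vertices above the floor row within `3L` of a marked point are deep** when `Λ` is the exact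
rows `≥ m` in `B(p, ρ)`, `3L < ρ`, and `T` stays `4L` away from `p` (`6δ < L`). [folklore] -/
theorem mem_deepSet_of_flat (hδL : 8 * δ ≤ L) (hLρ : 4 * L ≤ ρ)
    (hrow : ∀ v : HexVertex, (δ : ℂ) * hexCenter v ∈ ball p ρ → (v ∈ Λ ↔ m ≤ v.1 1))
    (hTfar : ∀ y ∈ T, 4 * L ≤ dist y p) (hδ : 0 < δ) {u : HexVertex}
    (hu : dist ((δ : ℂ) * hexCenter u) p < 3 * L)
    (huH : ((m : ℝ) + 1 / 3) * (δ * (Real.sqrt 3 / 2)) ≤ ((δ : ℂ) * hexCenter u).im) :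
    u ∈ {u : HexVertex | u ∈ Λ ∧ ∀ y ∈ T, 6 * δ < dist ((δ : ℂ) * hexCenter u) y} := by
  refine ⟨(hrow u (mem_ball.2 (by linarith))).2 ((row_le_iff_im hδ m u).2 huH), fun y hy => ?_⟩
  have := dist_triangle y ((δ : ℂ) * hexCenter u) p
  rw [dist_comm y ((δ : ℂ) * hexCenter u)] at this
  linarith [hTfar y hy]

/-- **Above the floor row near `p` ⟹ joined inside the deep set to every hub vertex** at
`p + iL` (when the floor row is low: threshold height `≤ Im p + L/2`). [folklore] -/
theorem pathIn_deepSet_of_low (hδ : 0 < δ) (hδL : 8 * δ ≤ L) (hLρ : 4 * L ≤ ρ)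
    (hrow : ∀ v : HexVertex, (δ : ℂ) * hexCenter v ∈ ball p ρ → (v ∈ Λ ↔ m ≤ v.1 1))
    (hTfar : ∀ y ∈ T, 4 * L ≤ dist y p)
    (hH : ((m : ℝ) + 1 / 3) * (δ * (Real.sqrt 3 / 2)) ≤ p.im + L / 2)
    {v : HexVertex} (hv : dist ((δ : ℂ) * hexCenter v) p ≤ L / 8) (hvΛ : v ∈ Λ)
    {z : HexVertex} (hz : dist ((δ : ℂ) * hexCenter z) (p + (L : ℂ) * Complex.I) ≤ δ) :
    PathIn hexGraph ({u : HexVertex | u ∈ Λ ∧ ∀ y ∈ T, 6 * δ < dist ((δ : ℂ) * hexCenter u) y}) v z := by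
  have hvH : ((m : ℝ) + 1 / 3) * (δ * (Real.sqrt 3 / 2)) ≤ ((δ : ℂ) * hexCenter v).im :=
    (row_le_iff_im hδ m v).1 ((hrow v (mem_ball.2 (by linarith))).1 hvΛ)
  exact (pathIn_flat_of_low hδ hδL hH hv hvH hz).mono fun u hu =>
    mem_deepSet_of_flat hδL hLρ hrow hTfar hδ hu.1 hu.2

/-- **Near the hub ⟹ joined inside the deep set to every hub vertex.** [folklore] -/
theorem pathIn_deepSet_of_high (hδ : 0 < δ) (hδL : 8 * δ ≤ L) (hLρ : 4 * L ≤ ρ)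
    (hrow : ∀ v : HexVertex, (δ : ℂ) * hexCenter v ∈ ball p ρ → (v ∈ Λ ↔ m ≤ v.1 1))
    (hTfar : ∀ y ∈ T, 4 * L ≤ dist y p)
    (hH : ((m : ℝ) + 1 / 3) * (δ * (Real.sqrt 3 / 2)) ≤ p.im + L / 2)
    {v : HexVertex} (hv : dist ((δ : ℂ) * hexCenter v) (p + (L : ℂ) * Complex.I) ≤ L / 4)
    {z : HexVertex} (hz : dist ((δ : ℂ) * hexCenter z) (p + (L : ℂ) * Complex.I) ≤ δ) :
    PathIn hexGraph ({u : HexVertex | u ∈ Λ ∧ ∀ y ∈ T, 6 * δ < dist ((δ : ℂ) * hexCenter u) y}) v z :=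
  (pathIn_flat_of_high hδ hδL hH hv hz).mono fun _ hu =>
    mem_deepSet_of_flat hδL hLρ hrow hTfar hδ hu.1 hu.2

end Flat

/-! ### Registry form -/

/-- **Registered sub-goal `stub_twoPieceAdmIdentification_component`** (crux item stmt-CriticalPhenomena-14005, line
`bridge-gate-renewal`, stub `stub_twoPieceAdmIdentification`): registry form of `simplyConnected_subFamily` — the component of the source in the deep vertices has connected complement. [cite: DuminilCopinSmirnov2012, §2 (domains: simply connected = connected complement)] -/
theorem stub_twoPieceAdmIdentification_component :
    ∀ (Ω : Set ℂ) (Λ : Finset HexVertex) (T : Set ℂ) (p₁ : ℂ) (ρ δ : ℝ) (m₁ : ℤ)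
      (va : HexVertex), 0 < δ → 8 * δ ≤ ρ →
      Ω ∩ ball p₁ ρ = {z : ℂ | p₁.im < z.im} ∩ ball p₁ ρ →
      (∀ v ∈ Λ, (δ : ℂ) * hexCenter v ∈ Ω) →
      (∀ v : HexVertex, (δ : ℂ) * hexCenter v ∈ ball p₁ ρ → (v ∈ Λ ↔ m₁ ≤ v.1 1)) →
      (∀ y ∈ T, ∃ Ty ⊆ T, IsPreconnected Ty ∧ y ∈ Ty ∧
        ∃ q ∈ Ty, q.im = p₁.im ∧ dist q p₁ < ρ / 4) →
      hexDomainSimplyConnected Λ →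
      (hexGraph.induce {z : HexVertex | PathIn hexGraph
        {u : HexVertex | u ∈ Λ ∧ ∀ y ∈ T, 6 * δ < dist ((δ : ℂ) * hexCenter u) y} va z}ᶜ).Preconnected :=
  fun Ω Λ T p₁ ρ δ m₁ va hδ hδρ hflat hΛΩ hrow hT hsc => by
    have h := simplyConnected_subFamily (va := va) hδ hδρ hflat hΛΩ hrow hT hsc
    unfold hexDomainSimplyConnected at h
    have hset : (↑(Λ.filter fun z => PathIn hexGraph {u : HexVertex | u ∈ Λ ∧ ∀ y ∈ T, 6 * δ < dist ((δ : ℂ) * hexCenter u) y} va z) : Set HexVertex) =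
        {z : HexVertex | PathIn hexGraph ({u : HexVertex | u ∈ Λ ∧ ∀ y ∈ T, 6 * δ < dist ((δ : ℂ) * hexCenter u) y}) va z} := by
      ext z
      rw [Finset.mem_coe, mem_subFamily_iff]
      rfl
    rw [hset] at h
    exact h

end Summit.CriticalPhenomena.SAWScalingLimit.Theorems.ObservableToSLER.TwoPiece

end
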